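import Summits.CriticalPhenomena.CardyFormulaZ2.Theorems.CardyIKTransportIKLinearTransportLine
import Literature.Probability.Percolation.CornerPercolation

/-!
# Stub `stub_TriLawOfEmpty` of the line `pinned-diagram-exchange` (crux stmt-CriticalPhenomena-5076)

`blackSet ∅ : Ω → Set (Site 2)` (colours of the `S = ∅` member of the column-mixed gauge) is measurable
and pushes `μIK` to `sitePercolation (Site 2) half`. On a box, (column bit at `0`, colours) is an
INJECTIVE function of the row/column bits and the fair plaquettes (a plaquette is the four-point
difference of rectangle parities) between cubes of equal size `2 ^ ((2n+1)² + 1)`, so every box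
marginal is uniform; boxes are cofinal (uniqueness of projective limits). No definitions declared.
-/

set_option autoImplicit false

noncomputable section

namespace Summit.CriticalPhenomena.CardyFormulaZ2.Theorems.IKLinearTransport.PinnedDiagramExchange

open scoped BigOperators Classical MeasureTheory ProbabilityTheory ENNReal symmDiff
open MeasureTheory Literature.Probability.Percolation Literature.Probability.LatticeModels

/-- Parity of a filtered symmetric difference is the `Xor` of the parities. [folklore] -/
theorem odd_card_filter_symmDiff {α : Type*} [DecidableEq α] (p : α → Prop) [DecidablePred p] (s t : Finset α) :
    Odd ((s ∆ t).filter p).card ↔ Xor (Odd (s.filter p).card) (Odd (t.filter p).card) := by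
  have hfilter : (s ∆ t).filter p = (s.filter p) ∆ (t.filter p) := by
    ext x; simp only [Finset.mem_filter, Finset.mem_symmDiff]; tauto
  have h2 := Finset.card_sdiff_add_card_inter (s.filter p) (t.filter p)
  have h3 := Finset.card_sdiff_add_card_inter (t.filter p) (s.filter p)
  rw [Finset.inter_comm] at h3
  rw [hfilter, Finset.symmDiff_def, Finset.card_union_of_disjoint disjoint_sdiff_sdiff, Nat.odd_iff,
    Nat.odd_iff, Nat.odd_iff, Xor]
  omega

/-- One-dimensional telescoping: consecutive half-open intervals from `0` differ in one point. [folklore] -/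
theorem Ico_succ_symmDiff (t : ℤ) :
    Finset.Ico (min 0 (t + 1)) (max 0 (t + 1)) ∆ Finset.Ico (min 0 t) (max 0 t) = {t} := by
  ext u; simp only [Finset.mem_symmDiff, Finset.mem_Ico, Finset.mem_singleton]; omega

/-- Symmetric differences of products with a common factor. [folklore] -/
theorem product_symmDiff {α β : Type*} [DecidableEq α] [DecidableEq β] (A B : Finset α) (C D : Finset β) :
    (A ×ˢ C) ∆ (B ×ˢ C) = (A ∆ B) ×ˢ C ∧ (A ×ˢ C) ∆ (A ×ˢ D) = A ×ˢ (C ∆ D) := by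
  constructor <;> ext x <;> simp only [Finset.mem_symmDiff, Finset.mem_product] <;> tauto

/-- `Xor` is associative. [folklore] -/
theorem xor_assoc_iff (a b c : Prop) : Xor (Xor a b) c ↔ Xor a (Xor b c) := by
  simp only [Xor]; tauto

/-- Cancellation in `Xor`. [folklore] -/
theorem xor_cancel {a b a' b' : Prop} (h : Xor a b ↔ Xor a' b') :
    ((b ↔ b') → (a ↔ a')) ∧ ((a ↔ a') → (b ↔ b')) := by
  simp only [Xor] at h; constructor <;> intro <;> tauto

/-- The four-point difference of the rectangle parities recovers the plaquette. [folklore] -/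
theorem four_point (x : ℤ × ℤ → Prop) (a b : ℤ) :
    x (a, b) ↔
      Xor (Odd ((Finset.Ico (min 0 (a + 1)) (max 0 (a + 1)) ×ˢ
          Finset.Ico (min 0 (b + 1)) (max 0 (b + 1))).filter x).card)
        (Xor (Odd ((Finset.Ico (min 0 a) (max 0 a) ×ˢ Finset.Ico (min 0 (b + 1)) (max 0 (b + 1))).filter x).card)
          (Xor (Odd ((Finset.Ico (min 0 (a + 1)) (max 0 (a + 1)) ×ˢ Finset.Ico (min 0 b) (max 0 b)).filter x).card)
            (Odd ((Finset.Ico (min 0 a) (max 0 a) ×ˢ Finset.Ico (min 0 b) (max 0 b)).filter x).card))) := by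
  have e1 := odd_card_filter_symmDiff x
    (Finset.Ico (min 0 (a + 1)) (max 0 (a + 1)) ×ˢ Finset.Ico (min 0 (b + 1)) (max 0 (b + 1)))
    (Finset.Ico (min 0 a) (max 0 a) ×ˢ Finset.Ico (min 0 (b + 1)) (max 0 (b + 1)))
  have e2 := odd_card_filter_symmDiff x
    (Finset.Ico (min 0 (a + 1)) (max 0 (a + 1)) ×ˢ Finset.Ico (min 0 b) (max 0 b))
    (Finset.Ico (min 0 a) (max 0 a) ×ˢ Finset.Ico (min 0 b) (max 0 b))
  rw [(product_symmDiff _ _ _ ∅).1, Ico_succ_symmDiff] at e1 e2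
  have e3 := odd_card_filter_symmDiff x (({a} : Finset ℤ) ×ˢ Finset.Ico (min 0 (b + 1)) (max 0 (b + 1)))
    (({a} : Finset ℤ) ×ˢ Finset.Ico (min 0 b) (max 0 b))
  rw [(product_symmDiff _ ∅ _ _).2, Ico_succ_symmDiff, Finset.singleton_product_singleton,
    Finset.filter_singleton] at e3
  have e0 : Odd (if x (a, b) then ({(a, b)} : Finset (ℤ × ℤ)) else ∅).card ↔ x (a, b) := by
    split_ifs with h <;> simp [h]
  rw [e0, e1, e2] at e3
  exact e3.trans (xor_assoc_iff _ _ _)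

/-- Membership in `blackSet ∅`: row bit, column bit and the FAIR plaquettes of the rectangle. [folklore] -/
theorem mem_blackSet_empty (ω : Ω) (v : Site 2) :
    v ∈ blackSet ∅ ω ↔ Xor (v 0 ∈ ω.1) (Xor (v 1 ∈ ω.2.1)
      (Odd ((Finset.Ico (min 0 (v 0)) (max 0 (v 0)) ×ˢ Finset.Ico (min 0 (v 1)) (max 0 (v 1))).filter
        (fun f : ℤ × ℤ => ![f.1, f.2] ∈ ω.2.2.2.1)).card)) := by
  simp only [blackSet, parSet, Set.mem_empty_iff_false, false_and, not_false_eq_true, true_and,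
    false_or, Set.setOf_mem_eq, Set.mem_setOf_eq]

/-- The same for an explicit cell `![s, t]`. [folklore] -/
theorem mem_blackSet_empty_vec (ω : Ω) (s t : ℤ) :
    (![s, t] : Site 2) ∈ blackSet ∅ ω ↔ Xor (s ∈ ω.1) (Xor (t ∈ ω.2.1)
      (Odd ((Finset.Ico (min 0 s) (max 0 s) ×ˢ Finset.Ico (min 0 t) (max 0 t)).filter
        (fun f : ℤ × ℤ => ![f.1, f.2] ∈ ω.2.2.2.1)).card)) := by
  simp only [mem_blackSet_empty, Matrix.cons_val_zero, Matrix.cons_val_one, Matrix.cons_val_fin_one]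

/-- On the axes the rectangle is empty: colour = row bit ⊕ column bit. [folklore] -/
theorem blackSet_empty_axes (ω : Ω) (a : ℤ) :
    ((![a, 0] : Site 2) ∈ blackSet ∅ ω ↔ Xor (a ∈ ω.1) ((0 : ℤ) ∈ ω.2.1)) ∧
      ((![0, a] : Site 2) ∈ blackSet ∅ ω ↔ Xor ((0 : ℤ) ∈ ω.1) (a ∈ ω.2.1)) := by
  have h0 : ¬ Odd 0 := Nat.not_odd_zero
  rw [mem_blackSet_empty_vec, mem_blackSet_empty_vec, min_self, max_self, Finset.Ico_self,
    Finset.product_empty, Finset.empty_product, Finset.filter_empty, Finset.card_empty]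
  simp only [Xor]
  constructor <;> tauto

/-- LOCALITY: with `hloc`, the colours on `B` only read the row/column bits on `A` and the fair
plaquettes on `Q`. [folklore] -/
theorem blackSet_empty_local (A : Finset ℤ) (Q B : Finset (Site 2))
    (hloc : ∀ v ∈ B, v 0 ∈ A ∧ v 1 ∈ A ∧ ∀ f ∈ Finset.Ico (min 0 (v 0)) (max 0 (v 0)) ×ˢ
      Finset.Ico (min 0 (v 1)) (max 0 (v 1)), (![f.1, f.2] : Site 2) ∈ Q)
    (ω ω' : Ω) (h1 : ∀ a ∈ A, (a ∈ ω.1 ↔ a ∈ ω'.1)) (h2 : ∀ b ∈ A, (b ∈ ω.2.1 ↔ b ∈ ω'.2.1))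
    (h3 : ∀ g ∈ Q, (g ∈ ω.2.2.2.1 ↔ g ∈ ω'.2.2.2.1)) (v : Site 2) (hv : v ∈ B) :
    (v ∈ blackSet ∅ ω ↔ v ∈ blackSet ∅ ω') := by
  obtain ⟨hv0, hv1, hf⟩ := hloc v hv
  rw [mem_blackSet_empty, mem_blackSet_empty, h1 (v 0) hv0, h2 (v 1) hv1,
    Finset.filter_congr fun f hf' => h3 _ (hf f hf')]

/-- RECOVERY (injectivity of the gauge): with the axis cells and the four cells around every plaquette
of `Q` inside `B`, the column bit at `0` and the colours on `B` determine the local data. [folklore] -/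
theorem blackSet_empty_recover (A : Finset ℤ) (Q B : Finset (Site 2))
    (hloc : ∀ v ∈ B, v 0 ∈ A ∧ v 1 ∈ A ∧ ∀ f ∈ Finset.Ico (min 0 (v 0)) (max 0 (v 0)) ×ˢ
      Finset.Ico (min 0 (v 1)) (max 0 (v 1)), (![f.1, f.2] : Site 2) ∈ Q)
    (h0A : (0 : ℤ) ∈ A) (hax : ∀ a ∈ A, (![a, 0] : Site 2) ∈ B ∧ (![0, a] : Site 2) ∈ B)
    (hpl : ∀ g ∈ Q, (![g 0 + 1, g 1 + 1] : Site 2) ∈ B ∧ (![g 0, g 1 + 1] : Site 2) ∈ B ∧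
      (![g 0 + 1, g 1] : Site 2) ∈ B ∧ (![g 0, g 1] : Site 2) ∈ B)
    (ω ω' : Ω) (h0 : ((0 : ℤ) ∈ ω.2.1 ↔ (0 : ℤ) ∈ ω'.2.1))
    (hc : ∀ v ∈ B, (v ∈ blackSet ∅ ω ↔ v ∈ blackSet ∅ ω')) :
    (∀ a ∈ A, (a ∈ ω.1 ↔ a ∈ ω'.1)) ∧ (∀ b ∈ A, (b ∈ ω.2.1 ↔ b ∈ ω'.2.1)) ∧
      (∀ g ∈ Q, (g ∈ ω.2.2.2.1 ↔ g ∈ ω'.2.2.2.1)) := by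
  have hrow : ∀ a ∈ A, (a ∈ ω.1 ↔ a ∈ ω'.1) := by
    intro a ha
    have h := hc _ (hax a ha).1
    rw [(blackSet_empty_axes ω a).1, (blackSet_empty_axes ω' a).1] at h
    exact (xor_cancel h).1 h0
  have hcol : ∀ b ∈ A, (b ∈ ω.2.1 ↔ b ∈ ω'.2.1) := by
    intro b hb
    have h := hc _ (hax b hb).2
    rw [(blackSet_empty_axes ω b).2, (blackSet_empty_axes ω' b).2] at h
    exact (xor_cancel h).2 (hrow 0 h0A)
  refine ⟨hrow, hcol, fun g hg => ?_⟩
  have hpar : ∀ s t : ℤ, (![s, t] : Site 2) ∈ B →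
      (Odd ((Finset.Ico (min 0 s) (max 0 s) ×ˢ Finset.Ico (min 0 t) (max 0 t)).filter
        (fun f : ℤ × ℤ => ![f.1, f.2] ∈ ω.2.2.2.1)).card ↔
       Odd ((Finset.Ico (min 0 s) (max 0 s) ×ˢ Finset.Ico (min 0 t) (max 0 t)).filter
        (fun f : ℤ × ℤ => ![f.1, f.2] ∈ ω'.2.2.2.1)).card) := by
    intro s t hst
    have h := hc _ hst
    rw [mem_blackSet_empty_vec, mem_blackSet_empty_vec] at h
    obtain ⟨hs, ht, -⟩ := hloc _ hst
    simp only [Matrix.cons_val_zero, Matrix.cons_val_one, Matrix.cons_val_fin_one] at hs ht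
    exact (xor_cancel ((xor_cancel h).2 (hrow s hs))).2 (hcol t ht)
  obtain ⟨b1, b2, b3, b4⟩ := hpl g hg
  have e := four_point (fun f : ℤ × ℤ => (![f.1, f.2] : Site 2) ∈ ω.2.2.2.1) (g 0) (g 1)
  have e' := four_point (fun f : ℤ × ℤ => (![f.1, f.2] : Site 2) ∈ ω'.2.2.2.1) (g 0) (g 1)
  have hg' : (![g 0, g 1] : Site 2) = g := by
    ext i; fin_cases i <;> rfl
  simp only [hg'] at e e'
  rw [e, e', hpar _ _ b1, hpar _ _ b2, hpar _ _ b3, hpar _ _ b4]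

/-- The local data (row bits on `A`, column bits on `A`, fair plaquettes on `Q`) are measurable. [folklore] -/
theorem measurable_loc (A : Finset ℤ) (Q : Finset (Site 2)) :
    Measurable (fun ω : Ω => ((fun a : ↥A => (a : ℤ) ∈ ω.1),
      ((fun b : ↥A => (b : ℤ) ∈ ω.2.1), (fun g : ↥Q => (g : Site 2) ∈ ω.2.2.2.1)))) := by
  refine Measurable.prodMk ?_ (Measurable.prodMk ?_ ?_)
  · exact measurable_pi_lambda _ fun a => (measurable_set_mem (a : ℤ)).comp measurable_fst
  · exact measurable_pi_lambda _ fun b =>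
      (measurable_set_mem (b : ℤ)).comp (measurable_fst.comp measurable_snd)
  · exact measurable_pi_lambda _ fun g => (measurable_set_mem (g : Site 2)).comp
      (measurable_fst.comp (measurable_snd.comp (measurable_snd.comp measurable_snd)))

/-- `sitePercolation _ half` is the push-forward of the product of fair coins on `Prop`. [folklore] -/
theorem sitePercolation_half_eq_map (ι : Type*) :
    sitePercolation ι half = (Measure.infinitePi fun _ : ι => (Ber(True, False, half) : Measure Prop)).map
      (fun q : ι → Prop => {i | q i}) := by
  rw [sitePercolation, ← prodBernoulli_const, prodBernoulli_eq_map]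
  rfl

/-- Finitely many coordinates of fair site percolation form a finite product of fair coins. [folklore] -/
theorem sitePercolation_map_restrict {ι : Type*} (A : Finset ι) :
    (sitePercolation ι half).map (fun s : Set ι => fun a : ↥A => (a : ι) ∈ s) =
      Measure.pi fun _ : ↥A => (Ber(True, False, half) : Measure Prop) := by
  have hA : Measurable (fun s : Set ι => fun a : ↥A => (a : ι) ∈ s) :=
    measurable_pi_lambda _ fun a => measurable_set_mem _
  rw [sitePercolation_half_eq_map, Measure.map_map hA measurable_setOf]
  exact Measure.infinitePi_map_restrict _

/-- The law of the local data: a product of uniform finite cubes. [folklore] -/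
theorem μIK_map_loc (A : Finset ℤ) (Q : Finset (Site 2)) :
    μIK.map (fun ω : Ω => ((fun a : ↥A => (a : ℤ) ∈ ω.1),
      ((fun b : ↥A => (b : ℤ) ∈ ω.2.1), (fun g : ↥Q => (g : Site 2) ∈ ω.2.2.2.1)))) =
      (Measure.pi fun _ : ↥A => (Ber(True, False, half) : Measure Prop)).prod
        ((Measure.pi fun _ : ↥A => (Ber(True, False, half) : Measure Prop)).prod
          (Measure.pi fun _ : ↥Q => (Ber(True, False, half) : Measure Prop))) := by
  have hA : Measurable (fun s : Set ℤ => fun a : ↥A => (a : ℤ) ∈ s) :=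
    measurable_pi_lambda _ fun a => measurable_set_mem _
  have hQ : Measurable (fun s : Set (Site 2) => fun g : ↥Q => (g : Site 2) ∈ s) :=
    measurable_pi_lambda _ fun g => measurable_set_mem _
  have hfun : (fun ω : Ω => ((fun a : ↥A => (a : ℤ) ∈ ω.1),
      ((fun b : ↥A => (b : ℤ) ∈ ω.2.1), (fun g : ↥Q => (g : Site 2) ∈ ω.2.2.2.1)))) =
      Prod.map (fun s : Set ℤ => fun a : ↥A => (a : ℤ) ∈ s)
        (Prod.map (fun s : Set ℤ => fun a : ↥A => (a : ℤ) ∈ s)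
          (((fun s : Set (Site 2) => fun g : ↥Q => (g : Site 2) ∈ s) ∘ Prod.fst) ∘
            (Prod.snd : Set (Site 2) × (Set (Site 2) × Set (Site 2)) → Set (Site 2) × Set (Site 2)))) :=
    rfl
  rw [hfun, μIK, ← Measure.map_prod_map _ _ hA (hA.prodMap ((hQ.comp measurable_fst).comp measurable_snd)),
    ← Measure.map_prod_map _ _ hA ((hQ.comp measurable_fst).comp measurable_snd),
    sitePercolation_map_restrict, ← Measure.map_map (hQ.comp measurable_fst) measurable_snd,
    Measure.map_snd_prod, measure_univ, one_smul, ← Measure.map_map hQ measurable_fst,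
    Measure.map_fst_prod, measure_univ, one_smul, sitePercolation_map_restrict]

/-- A bijection between finite sets transports "uniform" to "uniform". [folklore] -/
theorem map_eq_of_injective_of_singleton {α β : Type*} [MeasurableSpace α] [MeasurableSpace β]
    [Fintype α] [Fintype β] [MeasurableSingletonClass α] [MeasurableSingletonClass β]
    {μ : Measure α} {ν : Measure β} {f : α → β} (hf : Function.Injective f)
    (hcard : Fintype.card α = Fintype.card β) {c : ℝ≥0∞}
    (hμ : ∀ a, μ {a} = c) (hν : ∀ b, ν {b} = c) : μ.map f = ν := by
  have hbij : Function.Bijective f := (Fintype.bijective_iff_injective_and_card f).2 ⟨hf, hcard⟩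
  refine Measure.ext_of_singleton fun b => ?_
  obtain ⟨a, rfl⟩ := hbij.2 b
  rw [Measure.map_apply (measurable_of_finite f) (measurableSet_singleton _), hν (f a),
    ← Set.image_singleton, hf.preimage_image, hμ]

/-- THE FINITE GAUGE (abstract boxes `A, Q, B`): (column bit at `0`, colours on `B`) is measurable and
its law is (fair bit) ⊗ (uniform colouring of `B`) — an injective image of a uniform cube of equal size. [folklore] -/
theorem box_law (A : Finset ℤ) (Q B : Finset (Site 2))
    (hloc : ∀ v ∈ B, v 0 ∈ A ∧ v 1 ∈ A ∧ ∀ f ∈ Finset.Ico (min 0 (v 0)) (max 0 (v 0)) ×ˢ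
      Finset.Ico (min 0 (v 1)) (max 0 (v 1)), (![f.1, f.2] : Site 2) ∈ Q)
    (h0A : (0 : ℤ) ∈ A) (hax : ∀ a ∈ A, (![a, 0] : Site 2) ∈ B ∧ (![0, a] : Site 2) ∈ B)
    (hpl : ∀ g ∈ Q, (![g 0 + 1, g 1 + 1] : Site 2) ∈ B ∧ (![g 0, g 1 + 1] : Site 2) ∈ B ∧
      (![g 0 + 1, g 1] : Site 2) ∈ B ∧ (![g 0, g 1] : Site 2) ∈ B)
    (hcard : A.card + (A.card + Q.card) = B.card + 1) :
    Measurable (fun ω : Ω => (((0 : ℤ) ∈ ω.2.1), B.restrict (fun v : Site 2 => v ∈ blackSet ∅ ω))) ∧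
    μIK.map (fun ω : Ω => (((0 : ℤ) ∈ ω.2.1), B.restrict (fun v : Site 2 => v ∈ blackSet ∅ ω))) =
      (Ber(True, False, half) : Measure Prop).prod
        (Measure.pi fun _ : ↥B => (Ber(True, False, half) : Measure Prop)) := by
  obtain ⟨E, hE1, hE2⟩ : ∃ E : (↥A → Prop) × ((↥A → Prop) × (↥Q → Prop)) → Ω,
      (∀ z, ((fun a : ↥A => (a : ℤ) ∈ (E z).1), ((fun b : ↥A => (b : ℤ) ∈ (E z).2.1),
        (fun g : ↥Q => (g : Site 2) ∈ (E z).2.2.2.1))) = z) ∧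
      (∀ (ω : Ω) (z : (↥A → Prop) × ((↥A → Prop) × (↥Q → Prop))),
        ((fun a : ↥A => (a : ℤ) ∈ ω.1), ((fun b : ↥A => (b : ℤ) ∈ ω.2.1),
          (fun g : ↥Q => (g : Site 2) ∈ ω.2.2.2.1))) = z →
        (∀ a ∈ A, (a ∈ (E z).1 ↔ a ∈ ω.1)) ∧ (∀ b ∈ A, (b ∈ (E z).2.1 ↔ b ∈ ω.2.1)) ∧
          (∀ g ∈ Q, (g ∈ (E z).2.2.2.1 ↔ g ∈ ω.2.2.2.1))) := by
    refine ⟨fun z => ({a | ∃ h : a ∈ A, z.1 ⟨a, h⟩}, ({b | ∃ h : b ∈ A, z.2.1 ⟨b, h⟩},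
      (∅, ({g | ∃ h : g ∈ Q, z.2.2 ⟨g, h⟩}, ∅)))), fun z => ?_, ?_⟩
    · exact Prod.ext (funext fun a => propext ⟨fun ⟨_, h⟩ => h, fun h => ⟨a.2, h⟩⟩)
        (Prod.ext (funext fun b => propext ⟨fun ⟨_, h⟩ => h, fun h => ⟨b.2, h⟩⟩)
          (funext fun g => propext ⟨fun ⟨_, h⟩ => h, fun h => ⟨g.2, h⟩⟩))
    · rintro ω z rfl
      exact ⟨fun a ha => ⟨fun ⟨_, h⟩ => h, fun h => ⟨ha, h⟩⟩, fun b hb => ⟨fun ⟨_, h⟩ => h, fun h => ⟨hb, h⟩⟩,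
        fun g hg => ⟨fun ⟨_, h⟩ => h, fun h => ⟨hg, h⟩⟩⟩
  have hfac : (fun ω : Ω => (((0 : ℤ) ∈ ω.2.1), B.restrict (fun v : Site 2 => v ∈ blackSet ∅ ω))) =
      (fun z : (↥A → Prop) × ((↥A → Prop) × (↥Q → Prop)) =>
        (((0 : ℤ) ∈ (E z).2.1), B.restrict (fun v : Site 2 => v ∈ blackSet ∅ (E z)))) ∘
      (fun ω : Ω => ((fun a : ↥A => (a : ℤ) ∈ ω.1), ((fun b : ↥A => (b : ℤ) ∈ ω.2.1),
        (fun g : ↥Q => (g : Site 2) ∈ ω.2.2.2.1)))) := by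
    funext ω
    obtain ⟨h1, h2, h3⟩ := hE2 ω _ rfl
    exact (Prod.ext (propext (h2 0 h0A)) (funext fun v =>
      propext (blackSet_empty_local A Q B hloc _ _ h1 h2 h3 v.1 v.2))).symm
  have hinj : Function.Injective (fun z : (↥A → Prop) × ((↥A → Prop) × (↥Q → Prop)) =>
      (((0 : ℤ) ∈ (E z).2.1), B.restrict (fun v : Site 2 => v ∈ blackSet ∅ (E z)))) := by
    intro z z' h
    obtain ⟨h0, hc⟩ := Prod.ext_iff.1 h
    obtain ⟨h1, h2, h3⟩ := blackSet_empty_recover A Q B hloc h0A hax hpl (E z) (E z') (Iff.of_eq h0)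
      (fun v hv => Iff.of_eq (congrFun hc ⟨v, hv⟩))
    rw [← hE1 z, ← hE1 z']
    exact Prod.ext (funext fun a => propext (h1 a a.2))
      (Prod.ext (funext fun b => propext (h2 b b.2)) (funext fun g => propext (h3 g g.2)))
  rw [hfac]
  refine ⟨(measurable_of_finite _).comp (measurable_loc A Q), ?_⟩
  rw [← Measure.map_map (measurable_of_finite _) (measurable_loc A Q), μIK_map_loc A Q]
  refine map_eq_of_injective_of_singleton hinj ?_ (c := ENNReal.ofReal (1 / 2) ^ (B.card + 1)) ?_ ?_
  · simp only [Fintype.card_prod, Fintype.card_fun, Fintype.card_prop, Fintype.card_coe]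
    rw [← pow_add, ← pow_add, hcard, pow_succ']
  · rintro ⟨r, s, x⟩
    rw [← Set.singleton_prod_singleton, ← Set.singleton_prod_singleton, Measure.prod_prod,
      Measure.prod_prod, Measure.pi_singleton, Measure.pi_singleton, Measure.pi_singleton]
    simp only [bernoulli_half_singleton, Finset.prod_const, Finset.card_univ, Fintype.card_coe]
    rw [← pow_add, ← pow_add, hcard]
  · rintro ⟨b, y⟩
    rw [← Set.singleton_prod_singleton, Measure.prod_prod, Measure.pi_singleton]
    simp only [bernoulli_half_singleton, Finset.prod_const, Finset.card_univ, Fintype.card_coe]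
    rw [← pow_succ']

/-- A cell with coordinates in `[-n, n]` lies in the box `[-n, n]²`. [folklore] -/
theorem vec_mem_box (n : ℕ) (s t : ℤ) (h1 : -(n : ℤ) ≤ s) (h2 : s ≤ n) (h3 : -(n : ℤ) ≤ t)
    (h4 : t ≤ n) : (![s, t] : Site 2) ∈ Fintype.piFinset fun _ : Fin 2 => Finset.Icc (-(n : ℤ)) n := by
  refine Fintype.mem_piFinset.2 fun i => ?_
  fin_cases i
  · simpa using ⟨h1, h2⟩
  · simpa using ⟨h3, h4⟩

/-- The boxes `A = [-n, n]`, `Q = [-n, n-1]²`, `B = [-n, n]²` satisfy the hypotheses of `box_law`. [folklore] -/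
theorem boxes_ok (n : ℕ) :
    (∀ v ∈ (Fintype.piFinset fun _ : Fin 2 => Finset.Icc (-(n : ℤ)) n),
      v 0 ∈ Finset.Icc (-(n : ℤ)) n ∧ v 1 ∈ Finset.Icc (-(n : ℤ)) n ∧
      ∀ f ∈ Finset.Ico (min 0 (v 0)) (max 0 (v 0)) ×ˢ Finset.Ico (min 0 (v 1)) (max 0 (v 1)),
        (![f.1, f.2] : Site 2) ∈ (Fintype.piFinset fun _ : Fin 2 => Finset.Ico (-(n : ℤ)) n)) ∧
    (0 : ℤ) ∈ Finset.Icc (-(n : ℤ)) n ∧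
    (∀ a ∈ Finset.Icc (-(n : ℤ)) n,
      (![a, 0] : Site 2) ∈ (Fintype.piFinset fun _ : Fin 2 => Finset.Icc (-(n : ℤ)) n) ∧
      (![0, a] : Site 2) ∈ (Fintype.piFinset fun _ : Fin 2 => Finset.Icc (-(n : ℤ)) n)) ∧
    (∀ g ∈ (Fintype.piFinset fun _ : Fin 2 => Finset.Ico (-(n : ℤ)) n),
      (![g 0 + 1, g 1 + 1] : Site 2) ∈ (Fintype.piFinset fun _ : Fin 2 => Finset.Icc (-(n : ℤ)) n) ∧
      (![g 0, g 1 + 1] : Site 2) ∈ (Fintype.piFinset fun _ : Fin 2 => Finset.Icc (-(n : ℤ)) n) ∧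
      (![g 0 + 1, g 1] : Site 2) ∈ (Fintype.piFinset fun _ : Fin 2 => Finset.Icc (-(n : ℤ)) n) ∧
      (![g 0, g 1] : Site 2) ∈ (Fintype.piFinset fun _ : Fin 2 => Finset.Icc (-(n : ℤ)) n)) ∧
    (Finset.Icc (-(n : ℤ)) n).card + ((Finset.Icc (-(n : ℤ)) n).card +
      (Fintype.piFinset fun _ : Fin 2 => Finset.Ico (-(n : ℤ)) n).card) =
      (Fintype.piFinset fun _ : Fin 2 => Finset.Icc (-(n : ℤ)) n).card + 1 := by
  refine ⟨fun v hv => ?_, by simp, fun a ha => ?_, fun g hg => ?_, ?_⟩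
  · rw [Fintype.mem_piFinset] at hv
    have hv0 := hv 0
    have hv1 := hv 1
    rw [Finset.mem_Icc] at hv0 hv1
    refine ⟨Finset.mem_Icc.2 hv0, Finset.mem_Icc.2 hv1, fun f hf => ?_⟩
    rw [Finset.mem_product, Finset.mem_Ico, Finset.mem_Ico] at hf
    refine Fintype.mem_piFinset.2 fun i => ?_
    fin_cases i
    · simp only [Fin.zero_eta, Matrix.cons_val_zero, Finset.mem_Ico]; omega
    · simp only [Fin.mk_one, Matrix.cons_val_one, Matrix.cons_val_fin_one, Finset.mem_Ico]; omega
  · rw [Finset.mem_Icc] at ha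
    exact ⟨vec_mem_box n a 0 ha.1 ha.2 (by omega) (by omega),
      vec_mem_box n 0 a (by omega) (by omega) ha.1 ha.2⟩
  · rw [Fintype.mem_piFinset] at hg
    have hg0 := hg 0
    have hg1 := hg 1
    rw [Finset.mem_Ico] at hg0 hg1
    exact ⟨vec_mem_box n _ _ (by omega) (by omega) (by omega) (by omega),
      vec_mem_box n _ _ (by omega) (by omega) (by omega) (by omega),
      vec_mem_box n _ _ (by omega) (by omega) (by omega) (by omega),
      vec_mem_box n _ _ (by omega) (by omega) (by omega) (by omega)⟩
  · rw [Fintype.card_piFinset, Fintype.card_piFinset, Finset.prod_const, Finset.prod_const,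
      Finset.card_univ, Fintype.card_fin, Int.card_Icc, Int.card_Ico,
      show ((n : ℤ) + 1 - -(n : ℤ)).toNat = 2 * n + 1 by omega,
      show ((n : ℤ) - -(n : ℤ)).toNat = 2 * n by omega]
    ring

/-- MEASURABILITY of the colour field (each coordinate factors through a finite gauge). [folklore] -/
theorem measurable_colour : Measurable (fun (ω : Ω) (v : Site 2) => v ∈ blackSet ∅ ω) := by
  refine measurable_pi_lambda _ fun v => ?_
  obtain ⟨n, hv⟩ : ∃ n : ℕ, v ∈ Fintype.piFinset fun _ : Fin 2 => Finset.Icc (-(n : ℤ)) n := by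
    refine ⟨Finset.univ.sup fun i => (v i).natAbs, Fintype.mem_piFinset.2 fun i => ?_⟩
    have hi := Finset.le_sup (f := fun i => (v i).natAbs) (Finset.mem_univ i)
    rw [Finset.mem_Icc]
    omega
  obtain ⟨hloc, h0A, hax, hpl, hcard⟩ := boxes_ok n
  exact (measurable_pi_apply (⟨v, hv⟩ : ↥(Fintype.piFinset fun _ : Fin 2 => Finset.Icc (-(n : ℤ)) n))).comp
    (measurable_snd.comp (box_law _ _ _ hloc h0A hax hpl hcard).1)

/-- The colours on every box `[-n, n]²` are uniform. [folklore] -/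
theorem box_marginal (n : ℕ) :
    (μIK.map (fun (ω : Ω) (v : Site 2) => v ∈ blackSet ∅ ω)).map
      (Fintype.piFinset fun _ : Fin 2 => Finset.Icc (-(n : ℤ)) n).restrict =
      Measure.pi fun _ : ↥(Fintype.piFinset fun _ : Fin 2 => Finset.Icc (-(n : ℤ)) n) =>
        (Ber(True, False, half) : Measure Prop) := by
  obtain ⟨hloc, h0A, hax, hpl, hcard⟩ := boxes_ok n
  obtain ⟨hG, hlaw⟩ := box_law _ _ _ hloc h0A hax hpl hcard
  have hfac : (Fintype.piFinset fun _ : Fin 2 => Finset.Icc (-(n : ℤ)) n).restrict ∘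
      (fun (ω : Ω) (v : Site 2) => v ∈ blackSet ∅ ω) = Prod.snd ∘ (fun ω : Ω => (((0 : ℤ) ∈ ω.2.1),
        (Fintype.piFinset fun _ : Fin 2 => Finset.Icc (-(n : ℤ)) n).restrict
          (fun v : Site 2 => v ∈ blackSet ∅ ω))) := rfl
  rw [Measure.map_map (Finset.measurable_restrict _) measurable_colour, hfac,
    ← Measure.map_map measurable_snd hG, hlaw, Measure.map_snd_prod, measure_univ, one_smul]

/-- Uniform marginals on the cofinal boxes identify the product of fair coins (projective limits). [folklore] -/
theorem eq_infinitePi_of_boxes {ν : Measure (Site 2 → Prop)}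
    (h : ∀ n : ℕ, ν.map (Fintype.piFinset fun _ : Fin 2 => Finset.Icc (-(n : ℤ)) n).restrict =
      Measure.pi fun _ : ↥(Fintype.piFinset fun _ : Fin 2 => Finset.Icc (-(n : ℤ)) n) =>
        (Ber(True, False, half) : Measure Prop)) :
    ν = Measure.infinitePi fun _ : Site 2 => (Ber(True, False, half) : Measure Prop) := by
  refine IsProjectiveLimit.unique
    (P := fun I : Finset (Site 2) => Measure.pi fun _ : ↥I => (Ber(True, False, half) : Measure Prop))
    (fun I => ?_) (Measure.isProjectiveLimit_infinitePi _)
  obtain ⟨n, hn⟩ : ∃ n : ℕ, I ⊆ Fintype.piFinset fun _ : Fin 2 => Finset.Icc (-(n : ℤ)) n := by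
    refine ⟨I.sup fun v => Finset.univ.sup fun i => (v i).natAbs, fun v hv => ?_⟩
    refine Fintype.mem_piFinset.2 fun i => ?_
    have h1 : (v i).natAbs ≤ Finset.univ.sup fun j => (v j).natAbs :=
      Finset.le_sup (f := fun j => (v j).natAbs) (Finset.mem_univ i)
    have h2 : (Finset.univ.sup fun j => (v j).natAbs) ≤
        I.sup fun w => Finset.univ.sup fun j => (w j).natAbs :=
      Finset.le_sup (f := fun w : Site 2 => Finset.univ.sup fun j => (w j).natAbs) hv
    rw [Finset.mem_Icc]
    omega
  show ν.map I.restrict = Measure.pi fun _ : ↥I => (Ber(True, False, half) : Measure Prop)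
  rw [← Finset.restrict₂_comp_restrict hn, ← Measure.map_map (Finset.measurable_restrict₂ hn)
    (Finset.measurable_restrict _), h n]
  exact (isProjectiveMeasureFamily_pi (fun _ : Site 2 => (Ber(True, False, half) : Measure Prop)) _ I hn).symm

/-- STUB `stub_TriLawOfEmpty` · the colour field of the `S = ∅` member is i.i.d. fair: `blackSet ∅` is
measurable and pushes the gauge measure `μIK` forward to `sitePercolation (Site 2) half`. [folklore] -/
theorem stub_TriLawOfEmpty :
    Measurable (blackSet (∅ : Set ℤ)) ∧ μIK.map (blackSet ∅) = sitePercolation (Site 2) half := by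
  refine ⟨measurable_set_iff.2 fun v => (measurable_pi_apply v).comp measurable_colour, ?_⟩
  have hmap : μIK.map (blackSet ∅) =
      (μIK.map (fun (ω : Ω) (v : Site 2) => v ∈ blackSet ∅ ω)).map (fun q : Site 2 → Prop => {i | q i}) := by
    rw [Measure.map_map measurable_setOf measurable_colour]
    rfl
  rw [hmap, eq_infinitePi_of_boxes box_marginal, ← sitePercolation_half_eq_map]

end Summit.CriticalPhenomena.CardyFormulaZ2.Theorems.IKLinearTransport.PinnedDiagramExchange
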